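import Summits.HodgeConjecture.HodgeConjecture.Theorems.Ring2HypothesesDescentAbsoluteLefschetzStable
import Literature.AlgebraicGeometry.HodgeTheory.CurveCorrespondencePushforward
import Literature.AlgebraicGeometry.HodgeTheory.AbsoluteHodgeClassesDegreeZero
import HarnessLib

/-!
# Ring 2 — hypotheses layer, descent axis: THE PARENT NODE `AbsoluteHodgeImpliesAlgebraic` IS ITS MIDDLE-DEGREE SLICE
# WITHOUT `B(X)` — exterior products with powers of a polarisation class are absolute Hodge, and the Gysin
# push-forward descends algebraicity (modulo (N)+(E)+(c))

HONEST FRAMING (page 1, verbatim the cell's standing line): **research route conditional on HC_CM; not a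
corollary; Q11.4-sentence-2 already refuted in dim ≥ 3.** Nothing in this file proves a case of the Hodge conjecture;
nothing discharges the binder of record b06 `Ring2.Hypotheses.AbsoluteHodgeImpliesAlgebraicAV` or its parent node
`AbsoluteHodgeImpliesAlgebraic` (`Ring2HypothesesDescent.lean` :66 / :73; both OPEN); the binder table's numbers do not
move. `HC_CM` (`Theses.RankFourFaces.CMAbelianHodge`) does not occur in this file; `HC_AV` is not asserted.

Hodge ladder STAGE 3, `BINDER-OWNERS.md` row **b06**, seat `ring2-b06` (gen 71), fifth file of the gen. Gen 70 §4
(`absoluteHodgeImpliesAlgebraic_iff_middleDegree_of_standardConjectureBStar`) obtained the middle-degree form of the PARENT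
node only modulo Grothendieck's `B(X)` for every `X` ("descending from `L^{n−2p} x` to `x` is `*_L`, whose ALGEBRAICITY is
needed"). With the third file of this gen (full Lefschetz stability of absolute Hodge classes modulo (N)
`chartConjugation_canonical` + (E) existence of conjugates + (c) `deligne1982_lefschetz_absoluteHodge_iff`) the padding can
be done by EXTERIOR PRODUCTS instead, and the way back is a GYSIN PUSH-FORWARD (fact-free in the tree):

* §1 `isAbsoluteHodgeClass_cross_lefschetzPowTo_one_of_canonical` — for `a ∈ H^{2p}(X(ℂ); ℂ)` absolute Hodge and a
  polarisation class `κ` of a smooth projective `T`, every `pr_X^* a ∪ pr_T^* κᵗ` is absolute Hodge on `X × T`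
  (induction on `t`: `L_θ (a ⊠ κᵗ) = (η a) ⊠ κᵗ + a ⊠ κᵗ⁺¹` for the box sum `θ`, row b05's monomial calculus, and `L_θ`,
  `L_η` preserve absolute Hodge classes by the third file).
* §2 `mem_algebraicClasses_of_cross_top_mem` — DESCENT, fact-free: if `pr_X^* a ∪ pr_T^* ν` is algebraic on `X × T` for a
  non-zero TOP-degree class `ν` of `T`, then `a` is algebraic on `X`: `pr_{X*}(pr_T^* ν ∪ pr_X^* a) = λ · a` with `λ ≠ 0`
  (the tree's `complexGysin_fst_cupProduct_map_snd_top`, `complexGysin_fst_map_snd_ne_zero`) and Gysin maps preserve the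
  coniveau (`complexGysin_mem_algebraicClasses_of_mem_algebraicClasses`, Voisin II Prop. 9.21 (ii)).
* §3 **`absoluteHodgeImpliesAlgebraic_iff_middleDegree_of_canonical`: the parent node `↔` "every absolute Hodge class in the
  MIDDLE degree `H^{2m}` of every smooth projective complex variety of even dimension `2m ≥ 4` is algebraic"** (modulo
  (N)+(E)+(c), NO `B(X)`): for `a` of codimension `p`, `2p + j = n`, `j ≥ 1`, pad by a polarised abelian `j`-fold `B`
  (`κʲ = Lʲ 1 ≠ 0` by hard Lefschetz, `1` absolute Hodge in degree `0` fact-free): `pr_X^* a ∪ pr_B^* κʲ` is a middle-degree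
  absolute Hodge class of the `2(p+j)`-fold `X × B`; the rest of the row is gen 68's halving. Per variety:
  `forall_absoluteHodge_algebraic_lowerHalf_of_middle_prod_of_canonical`.

HONEST COLUMN. Nothing is discharged; «10 · 0» unchanged; both nodes OPEN and NOT asserted; (N), (E)/(G), (c) are named
facts displayed as hypotheses; no definition, no named fact, no sorry. NOT claimed: a primitive-AND-middle form of the
PARENT node (the descent of ring2-b02's lift uses `X ≅` abelian variety + Lieberman; for general `X` it would need the
algebraicity of `*_L`, i.e. `B(X)` again). Row b06's own middle / primitive-middle forms are gens 69 / 71 (fourth file).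

References (bib keys): Deligne1982HodgeCycles (§2 Ex. 2.1 (c), (d) p. 16), CharlesSchnell2014Notes (Def. 11.2.3,
Prop. 11.2.7–11.2.8, Cor. 11.2.12, Conj. 11.2.18), VoisinHodgeI2002 (§6.2.3 Thm. 6.25, §7.1.2, §11.1.2),
VoisinHodgeII2003 (§9.2.4 Prop. 9.20, Prop. 9.21 (ii)), FultonYoungTableaux1997 (App. B §B.1 (3)–(7)), HatcherAT2002
(§3.2 Thm. 3.15, §3.3 Thm. 3.26), BrosnanFangNiePearlstein2009 (§6 Lemma 48), MumfordAV1970 (§1). -/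

noncomputable section

set_option linter.dupNamespace false

open CategoryTheory AlgebraicGeometry MonoidalCategory CartesianMonoidalCategory
open Literature.AlgebraicTopology.SingularHomology Literature.Geometry.Kaehler
open Literature.AlgebraicGeometry Literature.AlgebraicGeometry.Motives
open Literature.AlgebraicGeometry.HodgeTheory
open Summit.HodgeConjecture.HodgeConjecture.Theorems

namespace Summit.HodgeConjecture.HodgeConjecture.Ring2.Hypotheses

/-! ## §1 Exterior products with powers of a polarisation class are absolute Hodge (modulo (N)+(E)+(c)) -/

section CrossPowers

variable {n m : ℕ} {X T : SchemeOver ℂ}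

/-- **`pr_X^* a ∪ pr_T^* κᵗ` is absolute Hodge for every `t`** (`κᵗ = L_κᵗ 1_T`; modulo (N)+(E)+(c)): `X`, `T` smooth
projective of dimensions `n`, `m`, `κ` a polarisation class of `T`, `a ∈ H^{2p}(X(ℂ); ℂ)` absolute Hodge. Induction on `t`:
`t = 0` is the pull-back `pr_X^* a`; for the box sum `θ = pr_X^* η + pr_T^* κ` (`η` any polarisation class of `X`),
`L_θ (a ⊠ κᵗ) = (η ∪ a) ⊠ κᵗ + a ⊠ κᵗ⁺¹` (row b05's `lefschetzPowTo_fst_cross` / `…_snd_cross`, count once THEIRS), and `L_θ`,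
`L_η` preserve absolute Hodge classes (third file, `isAbsoluteHodgeClass_lefschetzPowTo_all_of_canonical`). Degrees
`0 + 2t = e`, `p + t = q`, `2p + e = 2q`. [cite: CharlesSchnell2014Notes, Prop. 11.2.7 and Cor. 11.2.12]
[cite: Deligne1982HodgeCycles, §2 Example 2.1 (c), (d) (p. 16)] [cite: Andre1996Motifs, §1.3 (p. 12)] -/
theorem isAbsoluteHodgeClass_cross_lefschetzPowTo_one_of_canonical (hN : chartConjugation_canonical)
    (hex : ∀ ⦃n : ℕ⦄ ⦃X : SchemeOver ℂ⦄, IsSmoothProjective n X →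
      ∀ (σ : ℂ ≃+* ℂ) (p : ℕ) (c : complexBetti X (2 * p)), ∃ s, IsConjugateClass σ X (2 * p) c s)
    (h21c : deligne1982_lefschetz_absoluteHodge_iff) (hX : IsSmoothProjective n X) (hT : IsSmoothProjective m T)
    {η : complexBetti X 2} (hη : IsPolarizationClass n X η) {κ : complexBetti T 2} (hκ : IsPolarizationClass m T κ) :
    ∀ (t : ℕ) {p q e : ℕ} (he : 0 + 2 * t = e) (_ : p + t = q) (h : 2 * p + e = 2 * q) {a : complexBetti X (2 * p)},
      IsAbsoluteHodgeClass n X p a →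
        IsAbsoluteHodgeClass (n + m) (X ⊗ T) q
          (cupProduct h (complexBetti.map (fst X T) (2 * p) a)
            (complexBetti.map (snd X T) e
              (lefschetzPowTo κ t 0 e he (singularCohomology.one ℂ (ComplexPoints T))))) := by
  have hXT : IsSmoothProjective (n + m) (X ⊗ T) := IsSmoothProjective.tensor_holds hX hT
  have hθ := isPolarizationClass_boxSum hX hT hη hκ
  intro t
  induction t with
  | zero =>
    intro p q e he hq h a ha
    obtain rfl : e = 0 := by omega
    obtain rfl : p = q := by omega
    rw [lefschetzPowTo_zero_apply, singularCohomology.map_one, cupProduct_one]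
    exact absolutePullback_of_canonical hN hex hXT hX (fst X T) _ a ha
  | succ t ih =>
    intro p q e he hq h a ha
    obtain ⟨e', rfl⟩ : ∃ e', e = e' + 2 := ⟨e - 2, by omega⟩
    obtain ⟨q', rfl⟩ : ∃ q', q = q' + 1 := ⟨q - 1, by omega⟩
    -- `a ⊠ κᵗ` and `L_θ (a ⊠ κᵗ)` are absolute Hodge
    have h₀ := ih (e := e') (by omega) (show p + t = q' by omega) (by omega) ha
    have hL := isAbsoluteHodgeClass_lefschetzPowTo_all_of_canonical hN hex h21c hXT hθ q' (N := 1) rfl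
      (show 2 * q' + 2 * 1 = 2 * (q' + 1) by omega) h₀
    rw [lefschetzPowTo_boxSum_one_eq_add,
      lefschetzPowTo_fst_cross η (show 2 * p + e' = 2 * q' by omega) (show 2 * p + 2 * 1 = 2 * (p + 1) by omega)
        (show 2 * q' + 2 * 1 = 2 * (q' + 1) by omega) (show 2 * (p + 1) + e' = 2 * (q' + 1) by omega),
      lefschetzPowTo_snd_cross κ (show 2 * p + e' = 2 * q' by omega) (show e' + 2 * 1 = e' + 2 by omega)
        (show 2 * q' + 2 * 1 = 2 * (q' + 1) by omega) h,
      lefschetzPowTo_comp_apply κ (show t + 1 = t + 1 from rfl) _ _ he] at hL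
    -- `(η a) ⊠ κᵗ` is absolute Hodge (induction hypothesis for `η ∪ a`)
    have h₁ := ih (p := p + 1) (q := q' + 1) (e := e') (by omega) (by omega) (by omega)
      (isAbsoluteHodgeClass_lefschetzPowTo_all_of_canonical hN hex h21c hX hη p (N := 1) rfl
        (show 2 * p + 2 * 1 = 2 * (p + 1) by omega) ha)
    have h₂ := hL.sub_of_canonical hN hXT (fun σ d ↦ hex hXT σ (q' + 1) d) h₁
    rwa [add_sub_cancel_left] at h₂

end CrossPowers

/-! ## §2 Descent: the Gysin push-forward along `pr_X` (fact-free) -/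

section Descent

variable {n m : ℕ} {X T : SchemeOver ℂ}

/-- **DESCENT OF ALGEBRAICITY FROM `a ⊠ ν`, `ν` A NON-ZERO TOP-DEGREE CLASS** (fact-free). `X`, `T` smooth projective of
dimensions `n`, `m`, `ν ∈ H^{2m}(T(ℂ); ℂ)` non-zero, `a ∈ H^{2p}(X(ℂ); ℂ)`: if `pr_X^* a ∪ pr_T^* ν` is algebraic on `X × T`
then `a` is algebraic on `X`. Push forward along `pr_X`: `pr_{X*}(pr_T^* ν ∪ pr_X^* a) = λ · a` (projection formula,
`complexGysin_fst_cupProduct_map_snd_top`) with `λ · 1 = pr_{X*} pr_T^* ν ≠ 0` (`complexGysin_fst_map_snd_ne_zero`), and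
Gysin maps send `N^{p+m}` into `Nᵖ` (Voisin II Prop. 9.21 (ii), the tree's
`complexGysin_mem_algebraicClasses_of_mem_algebraicClasses`). [cite: VoisinHodgeII2003, §9.2.4 Prop. 9.21 (ii)]
[cite: FultonYoungTableaux1997, Appendix B §B.1 (5)–(7)] [cite: HatcherAT2002, §3.2 Thm. 3.15 and §3.3 Thm. 3.26] -/
theorem mem_algebraicClasses_of_cross_top_mem (hX : IsSmoothProjective n X) (hT : IsSmoothProjective m T)
    {ν : complexBetti T (2 * m)} (hν : ν ≠ 0) {p : ℕ} {a : complexBetti X (2 * p)}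
    (h : cupProduct (show 2 * p + 2 * m = 2 * (p + m) by omega) (complexBetti.map (fst X T) (2 * p) a)
      (complexBetti.map (snd X T) (2 * m) ν) ∈ algebraicClasses (X ⊗ T) (p + m)) :
    a ∈ algebraicClasses X p := by
  have hXT : IsSmoothProjective (n + m) (X ⊗ T) := IsSmoothProjective.tensor_holds hX hT
  obtain ⟨t⟩ := hT.nonempty_algPoints ℂ
  -- `pr_{X*} pr_T^* ν = λ · 1`, `λ ≠ 0`
  obtain ⟨lam, hlam⟩ := exists_eq_smul_one complexOrientationFamily hX
    (complexGysin complexOrientationFamily hXT hX (fst X T) (show 2 * m + 2 * n = 0 + 2 * (n + m) by omega)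
      (complexBetti.map (snd X T) (2 * m) ν))
  have hlam0 : lam ≠ 0 := by
    rintro rfl
    rw [zero_smul] at hlam
    exact complexGysin_fst_map_snd_ne_zero complexOrientationFamily hX hT hν hlam
  -- push the algebraic class forward
  have hG := complexGysin_mem_algebraicClasses_of_mem_algebraicClasses complexOrientationFamily hXT hX (fst X T)
    (e' := p + m) (e := p) (by omega) h
  rw [cupProduct_gradedComm_holds ℂ (ComplexPoints (X ⊗ T)) (show 2 * p + 2 * m = 2 * (p + m) by omega)
      (show 2 * m + 2 * p = 2 * (p + m) by omega),
    show ((-1 : ℂ) ^ (2 * p * (2 * m))) = 1 by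
      rw [show 2 * p * (2 * m) = 2 * (p * (2 * m)) by ring, pow_mul, neg_one_sq, one_pow], one_smul,
    complexGysin_fst_cupProduct_map_snd_top complexOrientationFamily hX hT hXT t ν lam hlam
      (show 2 * m + 2 * p = 2 * (p + m) by omega) (by omega) _,
    complexBetti_map_sliceAt_map_fst] at hG
  have h' := Submodule.smul_mem _ lam⁻¹ hG
  rwa [smul_smul, inv_mul_cancel₀ hlam0, one_smul] at h'

end Descent

/-! ## §3 The parent node is its middle-degree slice — no `B(X)` (modulo (N)+(E)+(c)) -/

section Middle

variable {n : ℕ} {X : SchemeOver ℂ}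

/-- **PER VARIETY: the absolute Hodge classes of codimension `p` on `X` are algebraic as soon as the absolute Hodge classes
of codimension `p + j` on `X × B` are, for ONE polarised smooth projective `j`-fold `B`** (modulo (N)+(E)+(c); used with
`2p + j = n`, where `p + j` is HALF the dimension of `X × B`): `κʲ = L_κʲ 1_B ≠ 0` (hard Lefschetz from degree `0`;
`1_B ≠ 0`), `pr_X^* a ∪ pr_B^* κʲ` is absolute Hodge of codimension `p + j` (§1; `1_B` is absolute Hodge in degree `0`,
fact-free), hence algebraic, and §2 descends. [cite: Deligne1982HodgeCycles, §2 Example 2.1 (c), (d) (p. 16)] [cite: VoisinHodgeII2003, §9.2.4 Prop. 9.21 (ii)]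
[cite: BrosnanFangNiePearlstein2009, §6 Lemma 48] -/
theorem absoluteHodge_algebraic_of_middle_prod_of_canonical (hN : chartConjugation_canonical)
    (hex : ∀ ⦃n : ℕ⦄ ⦃X : SchemeOver ℂ⦄, IsSmoothProjective n X →
      ∀ (σ : ℂ ≃+* ℂ) (p : ℕ) (c : complexBetti X (2 * p)), ∃ s, IsConjugateClass σ X (2 * p) c s)
    (h21c : deligne1982_lefschetz_absoluteHodge_iff) (hX : IsSmoothProjective n X) {j : ℕ} {B : SchemeOver ℂ}
    (hB : IsSmoothProjective j B) {κ : complexBetti B 2} (hκ : IsPolarizationClass j B κ) {p : ℕ}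
    (hmid : ∀ z : complexBetti (X ⊗ B) (2 * (p + j)), IsAbsoluteHodgeClass (n + j) (X ⊗ B) (p + j) z →
      z ∈ algebraicClasses (X ⊗ B) (p + j))
    (a : complexBetti X (2 * p)) (ha : IsAbsoluteHodgeClass n X p a) : a ∈ algebraicClasses X p := by
  obtain ⟨η, hη⟩ := exists_isPolarizationClass hX
  haveI := pathConnectedSpace_complexPoints hB
  -- `κʲ = Lʲ 1 ≠ 0`
  have hν : lefschetzPowTo κ j 0 (2 * j) (by omega) (singularCohomology.one ℂ (ComplexPoints B)) ≠ 0 := by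
    intro h0
    have hinj := (bijective_lefschetzPowTo_of_hasHardLefschetz κ hκ.hasHardLefschetz (show 0 + j = j by omega)
      (2 * j) (by omega)).1
    exact singularCohomology_one_ne_zero (R := ℂ) (M := ComplexPoints B) (hinj (h0.trans (map_zero _).symm))
  refine mem_algebraicClasses_of_cross_top_mem hX hB hν (hmid _ ?_)
  exact isAbsoluteHodgeClass_cross_lefschetzPowTo_one_of_canonical hN hex h21c hX hB hη hκ j (by omega) rfl
    (by omega) ha

/-- **BELOW THE MIDDLE FROM THE MIDDLE, on any smooth projective `X`** (modulo (N)+(E)+(c)): if every absolute Hodge class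
in the middle degree of every smooth projective complex variety of even dimension `2m ≥ 4` is algebraic, then every
absolute Hodge class of codimension `2 ≤ p`, `2p ≤ n` on `X` is algebraic (pad by a polarised abelian variety of dimension
`n − 2p`, `exists_abelianVariety_dim_eq_succ`). [cite: Deligne1982HodgeCycles, §2 Example 2.1 (c), (d) (p. 16)]
[cite: BrosnanFangNiePearlstein2009, §6 Lemma 48] [cite: MumfordAV1970, §1] -/
theorem forall_absoluteHodge_algebraic_lowerHalf_of_middle_of_canonical (hN : chartConjugation_canonical)
    (hex : ∀ ⦃n : ℕ⦄ ⦃X : SchemeOver ℂ⦄, IsSmoothProjective n X →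
      ∀ (σ : ℂ ≃+* ℂ) (p : ℕ) (c : complexBetti X (2 * p)), ∃ s, IsConjugateClass σ X (2 * p) c s)
    (h21c : deligne1982_lefschetz_absoluteHodge_iff)
    (hmid : ∀ ⦃N : ℕ⦄ ⦃Y : SchemeOver ℂ⦄, IsSmoothProjective N Y → ∀ m : ℕ, 2 ≤ m → N = 2 * m →
      ∀ z : complexBetti Y (2 * m), IsAbsoluteHodgeClass N Y m z → z ∈ algebraicClasses Y m)
    (hX : IsSmoothProjective n X) (p : ℕ) (hp : 2 ≤ p) (hpn : 2 * p ≤ n) (a : complexBetti X (2 * p))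
    (ha : IsAbsoluteHodgeClass n X p a) : a ∈ algebraicClasses X p := by
  obtain ⟨j, hj⟩ : ∃ j, 2 * p + j = n := ⟨n - 2 * p, by omega⟩
  rcases Nat.eq_zero_or_pos j with rfl | hj1
  · exact hmid hX p hp (by omega) a ha
  · obtain ⟨B, hBd⟩ := exists_abelianVariety_dim_eq_succ ℂ (j - 1)
    have hBsp : IsSmoothProjective B.dim B.X := AbelianVariety.isSmoothProjective_holds (A := B)
    obtain ⟨κ, hκ⟩ := exists_isPolarizationClass hBsp
    exact absoluteHodge_algebraic_of_middle_prod_of_canonical hN hex h21c hX hBsp hκ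
      (fun z hz ↦ hmid (IsSmoothProjective.tensor_holds hX hBsp) (p + B.dim) (by omega) (by omega) z hz) a ha

/-- **THE PARENT NODE `AbsoluteHodgeImpliesAlgebraic ↔` "every absolute Hodge class in the MIDDLE degree `H^{2m}` of every
smooth projective complex variety of even dimension `2m ≥ 4` is algebraic"** (modulo (N)+(E)+(c) — and NO standard
conjecture, in contrast with gen 70's `absoluteHodgeImpliesAlgebraic_iff_middleDegree_of_standardConjectureBStar`): the
lower half by `forall_absoluteHodge_algebraic_lowerHalf_of_middle_of_canonical`, the rest by gen 68's halving
(`absoluteHodgeImpliesAlgebraic_iff_lowerHalf`). Charles–Schnell's Conjecture 11.2.18 reduced to the middle degree;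
neither side is asserted. [cite: CharlesSchnell2014Notes, §11.2.5 Conj. 11.2.18 and Prop. 11.2.7]
[cite: Deligne1982HodgeCycles, §2 Example 2.1 (c), (d) (p. 16)] [cite: BrosnanFangNiePearlstein2009, §6 Lemma 48] -/
theorem absoluteHodgeImpliesAlgebraic_iff_middleDegree_of_canonical (hN : chartConjugation_canonical)
    (hex : ∀ ⦃n : ℕ⦄ ⦃X : SchemeOver ℂ⦄, IsSmoothProjective n X →
      ∀ (σ : ℂ ≃+* ℂ) (p : ℕ) (c : complexBetti X (2 * p)), ∃ s, IsConjugateClass σ X (2 * p) c s)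
    (h21c : deligne1982_lefschetz_absoluteHodge_iff) :
    AbsoluteHodgeImpliesAlgebraic ↔
      ∀ ⦃N : ℕ⦄ ⦃Y : SchemeOver ℂ⦄, IsSmoothProjective N Y → ∀ m : ℕ, 2 ≤ m → N = 2 * m →
        ∀ z : complexBetti Y (2 * m), IsAbsoluteHodgeClass N Y m z → z ∈ algebraicClasses Y m :=
  ⟨fun h _ _ hY m _ _ z hz ↦ h hY m z hz,
    fun h ↦ (absoluteHodgeImpliesAlgebraic_iff_lowerHalf h21c).2 fun _ _ hX p hp hpn c hc ↦
      forall_absoluteHodge_algebraic_lowerHalf_of_middle_of_canonical hN hex h21c h hX p hp hpn c hc⟩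

/-- **The same keyed to the named facts (N), (G), (c)** ((E) from Grothendieck's comparison fact (G) by gen 69's
`exists_isConjugateClass_even_of_grothendieck`). None of (N), (G), (c) is asserted.
[cite: Deligne1982HodgeCycles, §2 Example 2.1 (c), (d) (p. 16)] [cite: CharlesSchnell2014Notes, §11.2.2 (11.2.1)–(11.2.3) and Conj. 11.2.18] -/
theorem absoluteHodgeImpliesAlgebraic_iff_middleDegree_of_grothendieck (hN : chartConjugation_canonical)
    (hG : grothendieck_comparison_realize_surjective) (h21c : deligne1982_lefschetz_absoluteHodge_iff) :
    AbsoluteHodgeImpliesAlgebraic ↔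
      ∀ ⦃N : ℕ⦄ ⦃Y : SchemeOver ℂ⦄, IsSmoothProjective N Y → ∀ m : ℕ, 2 ≤ m → N = 2 * m →
        ∀ z : complexBetti Y (2 * m), IsAbsoluteHodgeClass N Y m z → z ∈ algebraicClasses Y m :=
  absoluteHodgeImpliesAlgebraic_iff_middleDegree_of_canonical hN (exists_isConjugateClass_even_of_grothendieck hG) h21c

end Middle

/-! ## Audit: nothing is decided here

No theorem above concludes `AbsoluteHodgeImpliesAlgebraic`, `AbsoluteHodgeImpliesAlgebraicAV`, `HC_AV` or `HC_CM`
outright: §2 is fact-free descent, the rest carries the undischarged hypotheses (N), (E)/(G), (c) (named facts of the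
tree, displayed, never asserted) and `hmid`. Axiom closures: the three standard axioms. -/

#print axioms Summit.HodgeConjecture.HodgeConjecture.Ring2.Hypotheses.absoluteHodgeImpliesAlgebraic_iff_middleDegree_of_canonical
#print axioms Summit.HodgeConjecture.HodgeConjecture.Ring2.Hypotheses.mem_algebraicClasses_of_cross_top_mem

end Summit.HodgeConjecture.HodgeConjecture.Ring2.Hypotheses

end
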